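import Summits.CriticalPhenomena.PercolationContinuityZ3.Theorems.PercNearOneGluingNoHeavyLowerTailAntitheticOneSidedCubes
import HarnessLib

/-!
# `NoHeavyLowerTail` (stmt-CriticalPhenomena-4575) — antithetic cluster pairs: PAIR-LEVEL CERTIFICATES (prim-hp-2 gen 58)

Support file (`--supports stmt-CriticalPhenomena-4575`, hull-port prover `prim-hp-2`, gen 58).  No definitions, no named facts, no sorries;
standard axioms.  Purely abstract bookkeeping that turns the one-sided cube LANGUAGE of HOME/THEOREM-OneSided.md (MEMO-gen56/58) into a
checkable CERTIFICATE FORMAT: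

* `Antithetic.pair_certificate_nonneg`: a finite family `a ∈ D` of objects (colourings) with pair values `π a` and a weight function `Φ`
  on pairs; if nonnegatively weighted PIECES `φ i : κ i → pairs` (each with `Σ_t Φ (φ i t) ≥ 0` and all values among the `π a`) reproduce
  the PAIR HISTOGRAM of `D` (`Σ_i w i · #{t : φ i t = z} = #{a ∈ D : π a = z}` for every value `z`), then `Σ_{a ∈ D} Φ (π a) ≥ 0`.
  With `Φ = K₁·K₂` and red-dominated cubes as pieces (`Antithetic.superodd_cube_sum_nonneg`) this is the 𝒦⁺-certificate of ⊕-positivity;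
  `Antithetic.oplus_of_pair_cubes` packages exactly that, in the shape of the ⊕-hypothesis of `Antithetic.Cut.cutVertex_termTwo_nonneg`.
* `Antithetic.odd_bluecube_sum_nonneg`: for ODD twisted-monotone `h₁, h₂` a BLUE-dominated cube (`Wr T ⊆ Wb Tᶜ`) also has
  `Σ_T h₁h₂ ≥ 0` (reindex `T ↦ Tᶜ` and swap the slots) — so certificates for TERM II / CHANGE may mix both kinds of cubes (𝒦^±).
* `Antithetic.card_fiber_inter_eq`, `Antithetic.sum_inter_restrict`, `Antithetic.sum_filter_inter_restrict`: a sum over ALL colourings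
  `ω : Set α` of a quantity depending only on `ω ∩ E` is a positive constant (`#{ω : ω ∩ E = ∅}`) times the sum over the sub-colourings
  `η ⊆ E`; hence such sums — e.g. the ⊕-hypothesis of the cut-vertex theorem, whose clusters are `openCluster (ω ∩ E₁) s` and
  `openCluster (ωᶜ ∩ E₁) s = openCluster (E₁ \ (ω ∩ E₁)) s` (`Antithetic.compl_inter_eq_diff`) — reduce to finite enumerations over `E₁`.
[cite: VandenbergHaggstromKahn2005, §1 p. 6 ("Harris' inequality")]
-/

noncomputable section

namespace Summit.CriticalPhenomena.PercolationContinuityZ3.Theorems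

open scoped Classical

namespace Antithetic

section PairCertificate

variable {V : Type*} {α : Type*}

/-- **Pair-level certificate theorem.**  `D` a finite family with pair values `π a`, `Φ` a weight on pairs; pieces `φ i : κ i → pairs`
(`i ∈ pieces`) with nonnegative weights `w i`, nonnegative piece sums `Σ_t Φ (φ i t)`, values among the values of `π` on `D`, and reproducing
the pair histogram of `D`.  Then `0 ≤ Σ_{a ∈ D} Φ (π a)`. [this work] -/
theorem pair_certificate_nonneg {β : Type*} [DecidableEq β] (D : Finset α) (π : α → β) (Φ : β → ℝ) {P : Type*} (pieces : Finset P)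
    (κ : P → Type*) [∀ i, Fintype (κ i)] (φ : ∀ i, κ i → β) (w : P → ℝ) (hw : ∀ i ∈ pieces, 0 ≤ w i)
    (hpos : ∀ i ∈ pieces, 0 ≤ ∑ t : κ i, Φ (φ i t)) (hmem : ∀ i ∈ pieces, ∀ t, φ i t ∈ D.image π)
    (hcover : ∀ z ∈ D.image π, ∑ i ∈ pieces, w i * ((Finset.univ.filter fun t : κ i => φ i t = z).card : ℝ) =
      ((D.filter fun a => π a = z).card : ℝ)) :
    0 ≤ ∑ a ∈ D, Φ (π a) := by
  have h1 : ∑ a ∈ D, Φ (π a) = ∑ z ∈ D.image π, ((D.filter fun a => π a = z).card : ℝ) * Φ z := by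
    rw [← Finset.sum_fiberwise_of_maps_to (s := D) (t := D.image π) (g := π) fun a ha => Finset.mem_image_of_mem π ha]
    refine Finset.sum_congr rfl fun z _ => ?_
    rw [Finset.sum_congr rfl fun a (ha : a ∈ D.filter fun a => π a = z) => by rw [(Finset.mem_filter.1 ha).2]]
    rw [Finset.sum_const, nsmul_eq_mul]
  have h2 : ∀ i ∈ pieces, ∑ t : κ i, Φ (φ i t) =
      ∑ z ∈ D.image π, ((Finset.univ.filter fun t : κ i => φ i t = z).card : ℝ) * Φ z := by
    intro i hi
    rw [← Finset.sum_fiberwise_of_maps_to (s := Finset.univ) (t := D.image π) (g := φ i) fun t _ => hmem i hi t]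
    refine Finset.sum_congr rfl fun z _ => ?_
    rw [Finset.sum_congr rfl fun t (ht : t ∈ Finset.univ.filter fun t => φ i t = z) => by rw [(Finset.mem_filter.1 ht).2]]
    rw [Finset.sum_const, nsmul_eq_mul]
  have key : ∑ z ∈ D.image π, ((D.filter fun a => π a = z).card : ℝ) * Φ z = ∑ i ∈ pieces, w i * ∑ t : κ i, Φ (φ i t) := by
    calc ∑ z ∈ D.image π, ((D.filter fun a => π a = z).card : ℝ) * Φ z
        = ∑ z ∈ D.image π, (∑ i ∈ pieces, w i * ((Finset.univ.filter fun t : κ i => φ i t = z).card : ℝ)) * Φ z :=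
          Finset.sum_congr rfl fun z hz => by rw [hcover z hz]
      _ = ∑ z ∈ D.image π, ∑ i ∈ pieces, w i * (((Finset.univ.filter fun t : κ i => φ i t = z).card : ℝ) * Φ z) := by
          refine Finset.sum_congr rfl fun z _ => ?_
          rw [Finset.sum_mul]
          exact Finset.sum_congr rfl fun i _ => by ring
      _ = ∑ i ∈ pieces, ∑ z ∈ D.image π, w i * (((Finset.univ.filter fun t : κ i => φ i t = z).card : ℝ) * Φ z) :=
          Finset.sum_comm
      _ = ∑ i ∈ pieces, w i * ∑ t : κ i, Φ (φ i t) := by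
          refine Finset.sum_congr rfl fun i hi => ?_
          rw [h2 i hi, Finset.mul_sum]
  rw [h1, key]
  exact Finset.sum_nonneg fun i hi => mul_nonneg (hw i hi) (hpos i hi)

/-- **Blue-dominated cubes are fine for ODD test functions.**  `Wr` monotone, `Wb` antitone, BLUE antipodal domination `Wr T ⊆ Wb Tᶜ`,
`h₁, h₂` odd (`h Q P = −h P Q`) and twisted-monotone: `0 ≤ Σ_T h₁ (Wr T) (Wb T) * h₂ (Wr T) (Wb T)` (reindex by `T ↦ Tᶜ`, swap the two slots
and use `Antithetic.superodd_cube_sum_nonneg`). [this work] -/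
theorem odd_bluecube_sum_nonneg {ι : Type*} [Fintype ι] (Wr Wb : Set ι → Set V) (hWr : Monotone Wr) (hWb : Antitone Wb)
    (hdom : ∀ T, Wr T ⊆ Wb Tᶜ) {h₁ h₂ : Set V → Set V → ℝ}
    (hh₁ : ∀ ⦃P P' Q Q' : Set V⦄, P ⊆ P' → Q' ⊆ Q → h₁ P Q ≤ h₁ P' Q') (hodd₁ : ∀ P Q, h₁ Q P = -h₁ P Q)
    (hh₂ : ∀ ⦃P P' Q Q' : Set V⦄, P ⊆ P' → Q' ⊆ Q → h₂ P Q ≤ h₂ P' Q') (hodd₂ : ∀ P Q, h₂ Q P = -h₂ P Q) :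
    0 ≤ ∑ T : Set ι, h₁ (Wr T) (Wb T) * h₂ (Wr T) (Wb T) := by
  -- the swapped, complemented family `T ↦ (Wb Tᶜ, Wr Tᶜ)` is a red-dominated cube
  have hsumc : ∀ (c : Set ι → ℝ), ∑ T : Set ι, c Tᶜ = ∑ T : Set ι, c T := fun c =>
    Fintype.sum_equiv (Equiv.mk compl compl compl_compl compl_compl) _ _ fun T => rfl
  have h3 : ∑ T : Set ι, h₁ (Wb Tᶜ) (Wr Tᶜ) * h₂ (Wb Tᶜ) (Wr Tᶜ) = ∑ T : Set ι, h₁ (Wb T) (Wr T) * h₂ (Wb T) (Wr T) :=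
    hsumc (fun T => h₁ (Wb T) (Wr T) * h₂ (Wb T) (Wr T))
  have hsum : ∑ T : Set ι, h₁ (Wr T) (Wb T) * h₂ (Wr T) (Wb T) = ∑ T : Set ι, h₁ (Wb Tᶜ) (Wr Tᶜ) * h₂ (Wb Tᶜ) (Wr Tᶜ) := by
    rw [h3]
    refine Finset.sum_congr rfl fun T _ => ?_
    rw [hodd₁ (Wr T) (Wb T), hodd₂ (Wr T) (Wb T)]; ring
  rw [hsum]
  refine superodd_cube_sum_nonneg (fun T => Wb Tᶜ) (fun T => Wr Tᶜ) (fun T T' hTT' => hWb (Set.compl_subset_compl.2 hTT'))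
    (fun T T' hTT' => hWr (Set.compl_subset_compl.2 hTT')) (fun T => ?_) hh₁ (fun P Q => ?_) hh₂ (fun P Q => ?_)
  · show Wr Tᶜᶜ ⊆ Wb Tᶜ
    rw [compl_compl]; exact hdom T
  · rw [hodd₁ P Q]; linarith
  · rw [hodd₂ P Q]; linarith

/-- **⊕-positivity from a 𝒦⁺-certificate** (pair-level red-dominated cubes), in the shape of the hypothesis of
`Antithetic.Cut.cutVertex_termTwo_nonneg`: if the pair histogram of `{a ∈ D}` under `(π₁, π₂)` is reproduced by nonnegatively weighted
red-dominated cubes `(Wr i, Wb i)` on `Set (ι i)`, then `Σ_{a ∈ D} K₁ (π₁ a) (π₂ a) * K₂ (π₁ a) (π₂ a) ≥ 0` for all twisted-monotone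
super-odd `K₁, K₂`. [this work] -/
theorem oplus_of_pair_cubes (D : Finset α) (π₁ π₂ : α → Set V) {P : Type*} (pieces : Finset P) (ι : P → Type*)
    [∀ i, Fintype (ι i)] (Wr Wb : ∀ i, Set (ι i) → Set V) (w : P → ℝ) (hw : ∀ i ∈ pieces, 0 ≤ w i)
    (hWr : ∀ i ∈ pieces, Monotone (Wr i)) (hWb : ∀ i ∈ pieces, Antitone (Wb i)) (hdom : ∀ i ∈ pieces, ∀ T, Wb i Tᶜ ⊆ Wr i T)
    (hmem : ∀ i ∈ pieces, ∀ T, (Wr i T, Wb i T) ∈ D.image fun a => (π₁ a, π₂ a))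
    (hcover : ∀ z ∈ D.image (fun a => (π₁ a, π₂ a)),
      ∑ i ∈ pieces, w i * ((Finset.univ.filter fun T : Set (ι i) => (Wr i T, Wb i T) = z).card : ℝ) =
        ((D.filter fun a => (π₁ a, π₂ a) = z).card : ℝ))
    {K₁ K₂ : Set V → Set V → ℝ}
    (hK₁ : ∀ ⦃P P' Q Q' : Set V⦄, P ⊆ P' → Q' ⊆ Q → K₁ P Q ≤ K₁ P' Q') (hso₁ : ∀ P Q, 0 ≤ K₁ P Q + K₁ Q P)
    (hK₂ : ∀ ⦃P P' Q Q' : Set V⦄, P ⊆ P' → Q' ⊆ Q → K₂ P Q ≤ K₂ P' Q') (hso₂ : ∀ P Q, 0 ≤ K₂ P Q + K₂ Q P) :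
    0 ≤ ∑ a ∈ D, K₁ (π₁ a) (π₂ a) * K₂ (π₁ a) (π₂ a) := by
  have h := pair_certificate_nonneg D (fun a => (π₁ a, π₂ a)) (fun z : Set V × Set V => K₁ z.1 z.2 * K₂ z.1 z.2) pieces
    (fun i => Set (ι i)) (fun i T => (Wr i T, Wb i T)) w hw (fun i hi => ?_) hmem hcover
  · simpa using h
  · exact superodd_cube_sum_nonneg (Wr i) (Wb i) (hWr i hi) (hWb i hi) (hdom i hi) hK₁ hso₁ hK₂ hso₂

end PairCertificate

section Restrict

variable {α : Type*} [Fintype α]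

/-- The fibres of `ω ↦ ω ∩ E` over the sub-colourings `η ⊆ E` all have the size of the fibre over `∅` (bijection `ω ↦ ω \ E`,
inverse `θ ↦ θ ∪ η`). [folklore] -/
theorem card_fiber_inter_eq (E η : Set α) (hη : η ⊆ E) :
    (Finset.univ.filter fun ω : Set α => ω ∩ E = η).card = (Finset.univ.filter fun ω : Set α => ω ∩ E = ∅).card := by
  refine Finset.card_bij (fun ω _ => ω \ E) (fun ω hω => ?_) (fun ω₁ h₁ ω₂ h₂ h => ?_) (fun θ hθ => ?_)
  · simp only [Finset.mem_filter, Finset.mem_univ, true_and]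
    ext e; simp
  · have e₁ : ω₁ ∩ E = η := (Finset.mem_filter.1 h₁).2
    have e₂ : ω₂ ∩ E = η := (Finset.mem_filter.1 h₂).2
    calc ω₁ = (ω₁ \ E) ∪ (ω₁ ∩ E) := by rw [Set.sdiff_union_inter]
      _ = (ω₂ \ E) ∪ (ω₂ ∩ E) := by rw [h, e₁, e₂]
      _ = ω₂ := by rw [Set.sdiff_union_inter]
  · have e₀ : θ ∩ E = ∅ := (Finset.mem_filter.1 hθ).2
    refine ⟨θ ∪ η, ?_, ?_⟩
    · simp only [Finset.mem_filter, Finset.mem_univ, true_and]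
      rw [Set.union_inter_distrib_right, e₀, Set.empty_union, Set.inter_eq_left.2 hη]
    · show (θ ∪ η) \ E = θ
      ext e
      simp only [Set.mem_sdiff, Set.mem_union]
      constructor
      · rintro ⟨h | h, hne⟩
        · exact h
        · exact absurd (hη h) hne
      · intro h
        exact ⟨Or.inl h, fun hE => (Set.mem_empty_iff_false e).1 (e₀ ▸ (⟨h, hE⟩ : e ∈ θ ∩ E))⟩

/-- **Restriction of a colouring sum.**  A sum over all colourings `ω : Set α` of a quantity depending only on `ω ∩ E` equals the fibre
size `#{ω : ω ∩ E = ∅}` times the sum over the sub-colourings `η ⊆ E`. [folklore] -/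
theorem sum_inter_restrict (E : Set α) (f : Set α → ℝ) :
    ∑ ω : Set α, f (ω ∩ E) = ((Finset.univ.filter fun ω : Set α => ω ∩ E = ∅).card : ℝ) *
      ∑ η ∈ Finset.univ.filter (fun η : Set α => η ⊆ E), f η := by
  rw [← Finset.sum_fiberwise_of_maps_to (s := Finset.univ) (t := Finset.univ.filter fun η : Set α => η ⊆ E)
    (g := fun ω : Set α => ω ∩ E) fun ω _ => Finset.mem_filter.2 ⟨Finset.mem_univ _, Set.inter_subset_right⟩]
  rw [Finset.mul_sum]
  refine Finset.sum_congr rfl fun η hη => ?_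
  have hηE : η ⊆ E := (Finset.mem_filter.1 hη).2
  rw [Finset.sum_congr rfl fun ω (hω : ω ∈ Finset.univ.filter fun ω : Set α => ω ∩ E = η) => by
      rw [(Finset.mem_filter.1 hω).2]]
  rw [Finset.sum_const, nsmul_eq_mul, card_fiber_inter_eq E η hηE]

/-- Filtered form: `Σ_{ω : p (ω ∩ E)} g (ω ∩ E) = #{ω : ω ∩ E = ∅} · Σ_{η ⊆ E, p η} g η`. [folklore] -/
theorem sum_filter_inter_restrict (E : Set α) (p : Set α → Prop) (g : Set α → ℝ) :
    ∑ ω ∈ Finset.univ.filter (fun ω : Set α => p (ω ∩ E)), g (ω ∩ E) =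
      ((Finset.univ.filter fun ω : Set α => ω ∩ E = ∅).card : ℝ) *
        ∑ η ∈ (Finset.univ.filter fun η : Set α => η ⊆ E).filter p, g η := by
  rw [Finset.sum_filter, Finset.sum_filter]
  have h := sum_inter_restrict E (fun η => if p η then g η else 0)
  simpa using h

/-- Sign form: positivity over the sub-colourings of `E` gives positivity over all colourings. [folklore] -/
theorem sum_filter_inter_nonneg (E : Set α) (p : Set α → Prop) (g : Set α → ℝ)
    (h : 0 ≤ ∑ η ∈ (Finset.univ.filter fun η : Set α => η ⊆ E).filter p, g η) :
    0 ≤ ∑ ω ∈ Finset.univ.filter (fun ω : Set α => p (ω ∩ E)), g (ω ∩ E) := by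
  rw [sum_filter_inter_restrict]
  exact mul_nonneg (Nat.cast_nonneg _) h

omit [Fintype α] in
/-- The blue sub-colouring of `E` is determined by the red one: `ωᶜ ∩ E = E \ (ω ∩ E)`. [folklore] -/
theorem compl_inter_eq_diff (ω E : Set α) : ωᶜ ∩ E = E \ (ω ∩ E) := by
  ext e
  simp only [Set.mem_inter_iff, Set.mem_compl_iff, Set.mem_sdiff]
  tauto

end Restrict

end Antithetic

end Summit.CriticalPhenomena.PercolationContinuityZ3.Theorems
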